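import Literature.Probability.RandomPlanarGeometry.ConformalMapCaratheodoryProofs
import Literature.Probability.RandomPlanarGeometry.RestrictionMapReflection
import Literature.Analysis.Complex.SchwarzReflection
import HarnessLib

/-!
# The chordal uniformizing map blows up non-tangentially at a straight boundary point

G. F. Lawler, O. Schramm, W. Werner, *Conformal invariance of planar loop-erased random walks
and uniform spanning trees*, Ann. Probab. **32** (2004), Thm. 4.4, parametrize the image
`γ̂ = φ ∘ γ` of the UST Peano curve "by capacity from `∞`" (§2.1), which presupposes that the
half-plane capacity of `γ̂(0, t]` tends to `∞` (G. F. Lawler, *Conformally Invariant Processes in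
the Plane* (2005), Prop. 4.4: "Suppose … `b(t) → ∞` as `t → ∞`"; p. 107: "Let us assume that
`hcap(K_t) → ∞`"). For a curve ending at the boundary point `b = φ(∞)` of a lattice domain along
a lattice edge transversal to the (locally straight) boundary this holds because the curve enters
`∞` inside a sector, and this file PROVES the underlying boundary estimate, by the Schwarz
reflection principle (Conway IX.1.1, the tree's `Complex.differentiableOn_schwarzReflection`) and
the nonvanishing of the derivative of the reflected map (`deriv_reflection_real`):

* `MarkedDomain.IsChordalUniformizing.exists_tendsto_symm_of_mem_frontier`,
  `….tendsto_symm_cocompact`, `….tendsto_symm_nhds_zero` — boundary behaviour of the INVERSE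
  `φ⁻¹ : D → ℍ` of a chordal uniformizing map (`φ → a` at `0`, `φ → b` at `∞`): `φ⁻¹ → ∞` at
  `b`, `φ⁻¹ → 0` at `a`, and `φ⁻¹ →` a NONZERO REAL number at every other boundary point
  (Carathéodory's theorem, `JordanDomain.exists_continuousOn_extension_holds`, in the half-plane
  form of `HalfPlaneAutomorphism`);
* `Complex.tendsto_im_neg_inv_atTop_of_upper_half_disc` — the analytic core: if `g` is holomorphic
  on the upper half-disc `B(0, r) ∩ ℍ` with `im g > 0`, `g → 0` at `0` and `g` has real boundary
  values along the rest of the diameter, then `im (-1/g(τ d)) → +∞` as `τ ↓ 0` for every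
  direction `d` with `im d > 0` (the reflection `R` of `g` is holomorphic at `0` with `R(0) = 0`,
  `R'(0) > 0`, so `g(τd) ≈ R'(0) τ d` stays in a sector);
* `MarkedDomain.IsChordalUniformizing.tendsto_im_symm_atTop` — **if `D` contains the open
  half-disc `b + ρ (B(0, r) ∩ ℍ)` whose diameter `b + ρ(-r, r)` lies on `∂D ∖ {a}`, then
  `im φ⁻¹(b + ρ τ d) → +∞` as `τ ↓ 0`** for every `d` with `im d > 0`; with the tree's
  `Loewner.im_sq_le_of_mem_hull` (`hcap ≥ (im)²/2` along a Loewner chain) this gives the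
  divergence of the capacity of `φ⁻¹ ∘ γ` for the UST Peano curve (`LSW2004USTProofs`).

## References

* G. F. Lawler, O. Schramm, W. Werner (2004), §2.1 and Thm. 4.4 [LawlerSchrammWerner2004].
* G. F. Lawler (2005), §4.1 Prop. 4.4, p. 107 [Lawler2005].
* J. B. Conway, *Functions of One Complex Variable I* (1978), IX.1.1 [Conway1978].
* Ch. Pommerenke, *Boundary Behaviour of Conformal Maps* (1992), Thm. 2.6 [PommerenkeBBCM1992].
-/

noncomputable section

open Set Filter Metric Complex Bornology Function
open _root_.Topology
open UpperHalfPlane (upperHalfPlaneSet isOpen_upperHalfPlaneSet)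
open scoped ComplexConjugate

namespace Literature.Probability.RandomPlanarGeometry

/-! ### The analytic core: reflection of a map of the upper half-disc into `ℍ` vanishing at `0` -/

/-- The closed upper half of `B(0, r)` lies in the closure of the open upper half. [folklore] -/
theorem upper_half_ball_subset_closure {r : ℝ} :
    ball (0 : ℂ) r ∩ {z : ℂ | 0 ≤ z.im} ⊆ closure (ball (0 : ℂ) r ∩ {z : ℂ | 0 < z.im}) := by
  rintro z ⟨hz, hzim⟩
  have hz' : z ∈ ball ((0 : ℝ) : ℂ) r := by simpa using hz
  have hev := _root_.Complex.eventually_add_mul_I_mem hz' hzim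
  have ht : Tendsto (fun y : ℝ ↦ z + y * I) (𝓝[>] 0) (𝓝 z) := by
    have hc : Continuous fun y : ℝ ↦ z + y * I := by fun_prop
    have h := hc.tendsto 0
    simp only [ofReal_zero, zero_mul, add_zero] at h
    exact h.mono_left nhdsWithin_le_nhds
  refine mem_closure_of_tendsto ht ?_
  filter_upwards [hev] with y hy
  simpa using hy

/-- A real point `x` with `|x| < r` lies in the closure of the open upper half of `B(0, r)`.
[folklore] -/
theorem ofReal_mem_closure_upper_half_ball {r x : ℝ} (hx : |x| < r) :
    (x : ℂ) ∈ closure (ball (0 : ℂ) r ∩ {z : ℂ | 0 < z.im}) :=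
  upper_half_ball_subset_closure ⟨by simpa [mem_ball_zero_iff] using hx, by simp⟩

/-- `((yI)⁻¹ w).re = w.im / y` for real `y`. [folklore] -/
theorem re_inv_ofReal_mul_I_mul (y : ℝ) (w : ℂ) : (((y : ℂ) * I)⁻¹ * w).re = w.im / y := by
  rcases eq_or_ne y 0 with rfl | hy
  · simp
  · have hyI : (y : ℂ) * I ≠ 0 := mul_ne_zero (ofReal_ne_zero.2 hy) I_ne_zero
    have key : ((y : ℂ) * I)⁻¹ * w = -(I * w) / y := by
      field_simp
      ring_nf
      rw [I_sq]
      ring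
    rw [key, div_ofReal_re, neg_re, mul_re, I_re, I_im]
    ring

/-- `im (-(τ w)⁻¹) = (im w / |w|²) τ⁻¹` for real `τ ≠ 0`. [folklore] -/
theorem im_neg_inv_ofReal_mul {τ : ℝ} (hτ : τ ≠ 0) (w : ℂ) :
    (-((τ : ℂ) * w)⁻¹).im = w.im / Complex.normSq w * τ⁻¹ := by
  rcases eq_or_ne w 0 with rfl | hw
  · simp
  · rw [neg_im, inv_im, normSq_mul, normSq_ofReal, im_ofReal_mul]
    have hn : Complex.normSq w ≠ 0 := (Complex.normSq_pos.2 hw).ne'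
    field_simp

/-- **Reflection at a boundary zero** (the analytic core). Let `g` be holomorphic on the upper
half-disc `S = B(0, r) ∩ ℍ` with `im g > 0` on `S`, `g → 0` at `0` within `S`, and, at every
real `x ≠ 0` with `|x| < r`, `g →` some real number within `S`. Then for every direction `d`
with `im d > 0`, `im (-1/g(τ d)) → +∞` as `τ ↓ 0`. Proof: `g` extends continuously and with real
values to the diameter, so its Schwarz reflection `R` is holomorphic on `B(0, r)`
(`Complex.differentiableOn_schwarzReflection`, Conway IX.1.1) with `R(0) = 0` and
`c = R'(0) ≠ 0` real (`deriv_reflection_real`), indeed `c > 0` (`im R(iy) > 0`); hence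
`g(τd) = τ d (c + o(1))` and `im(-1/g(τd)) = (im (d(c + o(1)))/|d (c + o(1))|²)/τ → +∞`.
[cite: Conway1978, Ch. IX Thm. 1.1] -/
theorem _root_.Complex.tendsto_im_neg_inv_atTop_of_upper_half_disc {g : ℂ → ℂ} {r : ℝ}
    (hr : 0 < r) (hd : DifferentiableOn ℂ g (ball (0 : ℂ) r ∩ {z : ℂ | 0 < z.im}))
    (hpos : ∀ z ∈ ball (0 : ℂ) r ∩ {z : ℂ | 0 < z.im}, 0 < (g z).im)
    (h0 : Tendsto g (𝓝[ball (0 : ℂ) r ∩ {z : ℂ | 0 < z.im}] 0) (𝓝 0))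
    (hbv : ∀ x : ℝ, |x| < r → x ≠ 0 →
      ∃ q : ℝ, Tendsto g (𝓝[ball (0 : ℂ) r ∩ {z : ℂ | 0 < z.im}] x) (𝓝 (q : ℂ)))
    {d : ℂ} (hdim : 0 < d.im) :
    Tendsto (fun τ : ℝ ↦ (-(g (τ * d))⁻¹).im) (𝓝[>] 0) atTop := by
  set S : Set ℂ := ball (0 : ℂ) r ∩ {z : ℂ | 0 < z.im} with hS
  -- boundary values at all real points of the diameter
  have hbv' : ∀ x : ℝ, |x| < r → ∃ q : ℝ, Tendsto g (𝓝[S] x) (𝓝 (q : ℂ)) := by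
    intro x hx
    rcases eq_or_ne x 0 with rfl | hx0
    · exact ⟨0, by simpa using h0⟩
    · exact hbv x hx hx0
  -- the continuous extension `f` to the closed upper half-disc
  set f : ℂ → ℂ := extendFrom S g with hf
  have hlim : ∀ z ∈ ball (0 : ℂ) r ∩ {z : ℂ | 0 ≤ z.im}, ∃ y, Tendsto g (𝓝[S] z) (𝓝 y) := by
    rintro z ⟨hz, hzim⟩
    have hzim' : 0 ≤ z.im := hzim
    rcases hzim'.lt_or_eq with hzpos | hz0
    · exact ⟨g z, hd.continuousOn z ⟨hz, hzpos⟩⟩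
    · have hzr : z = ((z.re : ℝ) : ℂ) := Complex.ext rfl (by simp [← hz0])
      have hx : |z.re| < r := (abs_re_le_norm z).trans_lt (mem_ball_zero_iff.1 hz)
      obtain ⟨q, hq⟩ := hbv' z.re hx
      rw [← hzr] at hq
      exact ⟨q, hq⟩
  have hfc : ContinuousOn f (ball (0 : ℂ) r ∩ {z : ℂ | 0 ≤ z.im}) :=
    continuousOn_extendFrom upper_half_ball_subset_closure hlim
  have hfg : EqOn f g S := fun z hz ↦ extendFrom_extends hd.continuousOn z hz
  have hfd : DifferentiableOn ℂ f S := hd.congr hfg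
  have hfreal : ∀ x : ℝ, |x| < r → (f x).im = 0 := by
    intro x hx
    obtain ⟨q, hq⟩ := hbv' x hx
    rw [hf, extendFrom_eq (ofReal_mem_closure_upper_half_ball hx) hq, ofReal_im]
  have hf0 : f 0 = 0 := by
    have h00 : ((0 : ℝ) : ℂ) ∈ closure S := ofReal_mem_closure_upper_half_ball (by simpa using hr)
    rw [ofReal_zero] at h00
    rw [hf, extendFrom_eq h00 h0]
  -- the Schwarz reflection `R`
  set R : ℂ → ℂ := schwarzReflection f with hRdef
  have hR : DifferentiableOn ℂ R (ball (0 : ℂ) r) := by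
    refine _root_.Complex.differentiableOn_schwarzReflection isOpen_ball (fun z hz ↦ ?_) hfc hfd ?_
    · simpa [mem_ball_zero_iff] using hz
    · intro z hz hzim
      have hzr : z = ((z.re : ℝ) : ℂ) := Complex.ext rfl (by simp [hzim])
      have hx : |z.re| < r := (abs_re_le_norm z).trans_lt (mem_ball_zero_iff.1 hz)
      rw [hzr]
      exact conj_eq_iff_im.2 (hfreal z.re hx)
  have hRreal : ∀ t : ℝ, |t| < r → (R t).im = 0 := fun t ht ↦ by
    rw [hRdef, schwarzReflection_ofReal]
    exact hfreal t ht
  have hRS : ∀ z ∈ S, R z = g z := fun z hz ↦ by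
    rw [hRdef, schwarzReflection_of_nonneg (le_of_lt hz.2), hfg hz]
  have hRpos : ∀ z ∈ upperHalfPlaneSet ∩ ball (0 : ℂ) r, 0 < (R z).im := by
    rintro z ⟨hzH, hz⟩
    have hzH' : 0 < z.im := hzH
    rw [hRS z ⟨hz, hzH'⟩]
    exact hpos z ⟨hz, hzH'⟩
  have hR0 : R 0 = 0 := by
    rw [hRdef, ← ofReal_zero, schwarzReflection_ofReal, ofReal_zero, hf0]
  obtain ⟨hc0, hcim⟩ := deriv_reflection_real hR hRreal hRpos (t := 0) (by simpa using hr)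
  rw [ofReal_zero] at hc0 hcim
  set c : ℂ := deriv R 0 with hcdef
  -- the difference quotient at `0`
  have hRd : HasDerivAt R c 0 :=
    (hR.differentiableAt (isOpen_ball.mem_nhds (mem_ball_self hr))).hasDerivAt
  have hslope : Tendsto (fun t : ℂ ↦ t⁻¹ * R t) (𝓝[≠] 0) (𝓝 c) := by
    have := hasDerivAt_iff_tendsto_slope_zero.1 hRd
    simpa [hR0] using this
  -- `c > 0`: approach along the imaginary axis
  have hcre : 0 < c.re := by
    have hcre0 : 0 ≤ c.re := by
      have hI : Tendsto (fun y : ℝ ↦ (y : ℂ) * I) (𝓝[>] 0) (𝓝[≠] 0) := by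
        refine tendsto_nhdsWithin_of_tendsto_nhds_of_eventually_within _ ?_ ?_
        · have hc : Continuous fun y : ℝ ↦ (y : ℂ) * I := by fun_prop
          have h := hc.tendsto 0
          simp only [ofReal_zero, zero_mul] at h
          exact h.mono_left nhdsWithin_le_nhds
        · filter_upwards [self_mem_nhdsWithin] with y hy
          exact mul_ne_zero (ofReal_ne_zero.2 (ne_of_gt hy)) I_ne_zero
      have h2 : Tendsto (fun y : ℝ ↦ (((y : ℂ) * I)⁻¹ * R (y * I)).re) (𝓝[>] 0) (𝓝 c.re) :=
        (continuous_re.tendsto c).comp (hslope.comp hI)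
      refine ge_of_tendsto h2 ?_
      filter_upwards [Ioo_mem_nhdsGT hr] with y hy
      have hyS : (y : ℂ) * I ∈ upperHalfPlaneSet ∩ ball (0 : ℂ) r := by
        refine ⟨?_, ?_⟩
        · show 0 < ((y : ℂ) * I).im
          simpa using hy.1
        · rw [mem_ball_zero_iff, norm_mul, norm_real, norm_I, mul_one, Real.norm_eq_abs,
            abs_of_pos hy.1]
          exact hy.2
      have hpos' := hRpos _ hyS
      show 0 ≤ (((y : ℂ) * I)⁻¹ * R (y * I)).re
      rw [re_inv_ofReal_mul_I_mul]
      exact (div_pos hpos' hy.1).le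
    have hcne : c.re ≠ 0 := fun h00 ↦ hc0 (Complex.ext h00 hcim)
    exact lt_of_le_of_ne hcre0 (Ne.symm hcne)
  -- the ray `τ d`
  have hd0 : d ≠ 0 := fun h ↦ by
    rw [h, zero_im] at hdim
    exact lt_irrefl _ hdim
  have hτd : Tendsto (fun τ : ℝ ↦ (τ : ℂ) * d) (𝓝[>] 0) (𝓝[≠] 0) := by
    refine tendsto_nhdsWithin_of_tendsto_nhds_of_eventually_within _ ?_ ?_
    · have hc : Continuous fun τ : ℝ ↦ (τ : ℂ) * d := by fun_prop
      have h := hc.tendsto 0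
      simp only [ofReal_zero, zero_mul] at h
      exact h.mono_left nhdsWithin_le_nhds
    · filter_upwards [self_mem_nhdsWithin] with τ hτ
      exact mul_ne_zero (ofReal_ne_zero.2 (ne_of_gt hτ)) hd0
  set qf : ℝ → ℂ := fun τ ↦ ((τ : ℂ) * d)⁻¹ * R (τ * d) with hqf
  have hq : Tendsto qf (𝓝[>] 0) (𝓝 c) := hslope.comp hτd
  -- the identity `im(-1/g(τd)) = (im (d q)/|d q|²) τ⁻¹` for small `τ > 0`
  have hev : (fun τ : ℝ ↦ (d * qf τ).im / Complex.normSq (d * qf τ) * τ⁻¹) =ᶠ[𝓝[>] 0]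
      fun τ : ℝ ↦ (-(g (τ * d))⁻¹).im := by
    have hmem : Ioo (0 : ℝ) (r / ‖d‖) ∈ 𝓝[>] (0 : ℝ) :=
      Ioo_mem_nhdsGT (div_pos hr (norm_pos_iff.2 hd0))
    filter_upwards [hmem] with τ hτ
    have hτ0 : (0 : ℝ) < τ := hτ.1
    have hzS : (τ : ℂ) * d ∈ S := by
      refine ⟨?_, ?_⟩
      · rw [mem_ball_zero_iff, norm_mul, norm_real, Real.norm_eq_abs, abs_of_pos hτ0]
        have := hτ.2
        rwa [lt_div_iff₀ (norm_pos_iff.2 hd0)] at this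
      · show 0 < ((τ : ℂ) * d).im
        rw [im_ofReal_mul]
        exact mul_pos hτ0 hdim
    have hτc : (τ : ℂ) ≠ 0 := ofReal_ne_zero.2 hτ0.ne'
    have hRq : g (τ * d) = (τ : ℂ) * (d * qf τ) := by
      rw [← hRS _ hzS, hqf]
      field_simp
    rw [hRq, im_neg_inv_ofReal_mul hτ0.ne']
  -- the limit of the prefactor and the conclusion
  have hdc : d * c ≠ 0 := mul_ne_zero hd0 hc0
  have hκ : Tendsto (fun τ ↦ (d * qf τ).im / Complex.normSq (d * qf τ)) (𝓝[>] 0)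
      (𝓝 ((d * c).im / Complex.normSq (d * c))) := by
    have h1 : Tendsto (fun τ ↦ d * qf τ) (𝓝[>] 0) (𝓝 (d * c)) := hq.const_mul d
    exact ((continuous_im.tendsto _).comp h1).div ((Complex.continuous_normSq.tendsto _).comp h1)
      (Complex.normSq_pos.2 hdc).ne'
  have hκpos : 0 < (d * c).im / Complex.normSq (d * c) := by
    refine div_pos ?_ (Complex.normSq_pos.2 hdc)
    rw [mul_im, hcim, mul_zero, zero_add]
    exact mul_pos hdim hcre
  exact (hκ.pos_mul_atTop hκpos tendsto_inv_nhdsGT_zero).congr' hev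

/-! ### Boundary behaviour of the inverse of a chordal uniformizing map -/

namespace MarkedDomain.IsChordalUniformizing

variable {D : DobrushinDomain} {φ : ConformalEquiv upperHalfPlaneSet D.carrier}

/-- **`φ⁻¹ → ∞` at `b`**: for a chordal uniformizing map `φ` of `(D; a, b)` (`φ → b` at `∞`),
`φ⁻¹(w) → ∞` as `w → b` within `D` (Carathéodory, `JordanDomain.tendsto_symm_cocompact` with
`JordanDomain.exists_continuousOn_extension_holds`). [cite: PommerenkeBBCM1992, Thm. 2.6] -/
theorem tendsto_symm_cocompact (hφ : D.IsChordalUniformizing φ) :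
    Tendsto φ.symm (𝓝[D.carrier] (D.pt 1)) (cocompact ℂ) := by
  obtain ⟨Ψ, hΨc, hΨeq, hbij, -⟩ :=
    JordanDomain.exists_continuousOn_extension_holds D.toJordanDomain (cayley.symm.trans φ)
  exact JordanDomain.tendsto_symm_cocompact φ hΨc hΨeq hbij.injOn hφ.2

/-- **`φ⁻¹ → 0` at `a`** (`φ → a` at `0`; Carathéodory, `JordanDomain.tendsto_symm_nhds`).
[cite: PommerenkeBBCM1992, Thm. 2.6] -/
theorem tendsto_symm_nhds_zero (hφ : D.IsChordalUniformizing φ) :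
    Tendsto φ.symm (𝓝[D.carrier] (D.pt 0)) (𝓝 0) := by
  obtain ⟨Ψ, hΨc, hΨeq, hbij, -⟩ :=
    JordanDomain.exists_continuousOn_extension_holds D.toJordanDomain (cayley.symm.trans φ)
  have := JordanDomain.tendsto_symm_nhds φ hΨc hΨeq hbij.injOn (x := 0) (a := D.pt 0)
    (by exact_mod_cast hφ.1)
  simpa using this

/-- **Boundary values of `φ⁻¹` off the marked points are nonzero reals**: at a boundary point
`p ∈ ∂D`, `p ≠ a, b`, the inverse of a chordal uniformizing map tends within `D` to a real
number `q ≠ 0` (the boundary correspondence `ℝ ∪ {∞} → ∂D` of Carathéodory's theorem is a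
bijection taking `0 ↦ a`, `∞ ↦ b`). [cite: PommerenkeBBCM1992, Thm. 2.6] -/
theorem exists_tendsto_symm_of_mem_frontier (hφ : D.IsChordalUniformizing φ) {p : ℂ}
    (hp : p ∈ frontier D.carrier) (hpa : p ≠ D.pt 0) (hpb : p ≠ D.pt 1) :
    ∃ q : ℝ, q ≠ 0 ∧ Tendsto φ.symm (𝓝[D.carrier] p) (𝓝 (q : ℂ)) := by
  obtain ⟨Ψ, hΨc, hΨeq, hbij, hbijfr⟩ :=
    JordanDomain.exists_continuousOn_extension_holds D.toJordanDomain (cayley.symm.trans φ)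
  have hinj : InjOn Ψ (closedBall 0 1) := hbij.injOn
  obtain ⟨ζ, hζs, rfl⟩ := hbijfr.surjOn hp
  have hζn : ‖ζ‖ = 1 := by simpa using hζs
  have hζ1 : ζ ≠ 1 := by
    intro h1
    apply hpb
    rw [h1]
    exact JordanDomain.extension_one_eq φ hΨc hΨeq hφ.2
  have h1 := JordanDomain.tendsto_cayleyFun_symm φ hΨc hΨeq hinj (sphere_subset_closedBall hζs)
  have h2 : ContinuousAt cayleyInvFun ζ :=
    differentiableOn_cayleyInvFun.continuousOn.continuousAt (isOpen_ne.mem_nhds hζ1)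
  have h3 : Tendsto φ.symm (𝓝[D.carrier] (Ψ ζ)) (𝓝 (cayleyInvFun ζ)) := by
    refine (h2.tendsto.comp h1).congr' ?_
    filter_upwards [self_mem_nhdsWithin] with w hw
    exact cayleyInvFun_cayleyFun (add_I_ne_zero (le_of_lt (φ.symm_mapsTo hw)))
  set q : ℂ := cayleyInvFun ζ with hqdef
  have hqim : q.im = 0 := cayleyInvFun_im_eq_zero hζn
  have hq : ((q.re : ℝ) : ℂ) = q := Complex.ext rfl (by simp [hqim])
  refine ⟨q.re, fun hq0 ↦ hpa ?_, by rw [hq]; exact h3⟩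
  have hq0' : q = 0 := by rw [← hq, hq0, ofReal_zero]
  have hζ0 : ζ = cayleyFun ((0 : ℝ) : ℂ) := by
    rw [ofReal_zero, ← hq0', hqdef, cayleyFun_cayleyInvFun hζ1]
  rw [hζ0]
  exact JordanDomain.extension_cayleyFun_eq φ hΨc hΨeq (x := 0) (p := D.pt 0) (by exact_mod_cast hφ.1)

/-- **Non-tangential blow-up of `φ⁻¹` at `b` across a straight piece of boundary.** Let `φ` be a
chordal uniformizing map of `(D; a, b)` and suppose that, for some `ρ ≠ 0` and `r > 0`, the open
half-disc `b + ρ (B(0, r) ∩ ℍ)` lies in `D` while its diameter `b + ρ(-r, r)` lies on `∂D` and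
avoids `a`. Then `im φ⁻¹(b + ρ τ d) → +∞` as `τ ↓ 0`, for every direction `d` with `im d > 0`.
Proof: `g(z) = -1/φ⁻¹(b + ρ z)` is a holomorphic map of the upper half-disc into `ℍ`, tends to
`0` at `0` (`φ⁻¹ → ∞` at `b`) and to nonzero reals along the rest of the diameter
(`exists_tendsto_symm_of_mem_frontier`); apply
`Complex.tendsto_im_neg_inv_atTop_of_upper_half_disc`. This is the estimate behind "parametrized
by capacity from `∞`" for a curve reaching `b` along a segment transversal to `∂D`
([LSW04] Thm. 4.4; Lawler (2005), Prop. 4.4 assumes `b(t) → ∞`). [cite: Lawler2005, Prop. 4.4] -/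
theorem tendsto_im_symm_atTop (hφ : D.IsChordalUniformizing φ) {ρ : ℂ} (hρ : ρ ≠ 0) {r : ℝ}
    (hr : 0 < r) (hin : ∀ z : ℂ, ‖z‖ < r → 0 < z.im → D.pt 1 + ρ * z ∈ D.carrier)
    (hfr : ∀ x : ℝ, |x| < r → D.pt 1 + ρ * x ∈ frontier D.carrier)
    (hne : ∀ x : ℝ, |x| < r → D.pt 1 + ρ * x ≠ D.pt 0) {d : ℂ} (hdim : 0 < d.im) :
    Tendsto (fun τ : ℝ ↦ (φ.symm (D.pt 1 + ρ * (τ * d))).im) (𝓝[>] 0) atTop := by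
  set S : Set ℂ := ball (0 : ℂ) r ∩ {z : ℂ | 0 < z.im} with hS
  set A : ℂ → ℂ := fun z ↦ D.pt 1 + ρ * z with hA
  set g : ℂ → ℂ := fun z ↦ -(φ.symm (A z))⁻¹ with hg
  have hAc : Continuous A := by fun_prop
  have hAS : MapsTo A S D.carrier := fun z hz ↦ hin z (mem_ball_zero_iff.1 hz.1) hz.2
  have hAt : ∀ z : ℂ, Tendsto A (𝓝[S] z) (𝓝[D.carrier] (A z)) := fun z ↦
    tendsto_nhdsWithin_of_tendsto_nhds_of_eventually_within _
      ((hAc.tendsto z).mono_left nhdsWithin_le_nhds)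
      (eventually_nhdsWithin_of_forall fun w hw ↦ hAS hw)
  have hH : ∀ z ∈ S, φ.symm (A z) ∈ upperHalfPlaneSet := fun z hz ↦ φ.symm_mapsTo (hAS hz)
  have hne0 : ∀ z ∈ S, φ.symm (A z) ≠ 0 := fun z hz h0 ↦ by
    have : (0 : ℝ) < (φ.symm (A z)).im := hH z hz
    rw [h0, zero_im] at this
    exact lt_irrefl _ this
  -- `g` is a holomorphic map of the upper half-disc into `ℍ`
  have hgd : DifferentiableOn ℂ g S := by
    have h1 : DifferentiableOn ℂ (fun z ↦ φ.symm (A z)) S :=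
      φ.symm.differentiableOn_coe.comp (by fun_prop) hAS
    exact (h1.inv hne0).neg
  have hgpos : ∀ z ∈ S, 0 < (g z).im := by
    intro z hz
    have hw := hH z hz
    have hw' : (0 : ℝ) < (φ.symm (A z)).im := hw
    simp only [hg, neg_im, inv_im, neg_div, neg_neg]
    exact div_pos hw' (Complex.normSq_pos.2 (hne0 z hz))
  -- `g → 0` at `0`
  have hg0 : Tendsto g (𝓝[S] 0) (𝓝 0) := by
    have h1 : Tendsto (fun z ↦ φ.symm (A z)) (𝓝[S] 0) (cocompact ℂ) := by
      have hA0 : A 0 = D.pt 1 := by simp [hA]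
      have h := hAt 0
      rw [hA0] at h
      exact hφ.tendsto_symm_cocompact.comp h
    rw [← cobounded_eq_cocompact] at h1
    have h2 := (Filter.tendsto_inv₀_cobounded.comp h1).neg
    rw [neg_zero] at h2
    exact h2
  -- real nonzero boundary values along the rest of the diameter
  have hgbv : ∀ x : ℝ, |x| < r → x ≠ 0 → ∃ q : ℝ, Tendsto g (𝓝[S] x) (𝓝 (q : ℂ)) := by
    intro x hx hx0
    have hpb : A x ≠ D.pt 1 := by
      simp only [hA, ne_eq, add_eq_left]
      exact mul_ne_zero hρ (ofReal_ne_zero.2 hx0)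
    obtain ⟨q, hq0, hq⟩ := hφ.exists_tendsto_symm_of_mem_frontier (hfr x hx) (hne x hx) hpb
    refine ⟨-q⁻¹, ?_⟩
    have h1 : Tendsto (fun z ↦ φ.symm (A z)) (𝓝[S] x) (𝓝 (q : ℂ)) := hq.comp (hAt x)
    have h2 := (h1.inv₀ (ofReal_ne_zero.2 hq0)).neg
    push_cast
    exact h2
  have key := _root_.Complex.tendsto_im_neg_inv_atTop_of_upper_half_disc hr hgd hgpos hg0 hgbv hdim
  refine key.congr' (Eventually.of_forall fun τ ↦ ?_)
  simp only [hg, hA, inv_neg, inv_inv, neg_neg]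

end MarkedDomain.IsChordalUniformizing

end Literature.Probability.RandomPlanarGeometry
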